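import Mathlib.Combinatorics.SetFamily.FourFunctions
import Mathlib.Algebra.Order.BigOperators.Group.Finset
import Mathlib.Algebra.BigOperators.Ring.Finset
import Mathlib.Data.Real.Basic
import Mathlib.Data.Finset.Powerset
import Mathlib.Tactic.Linarith
import Mathlib.Tactic.Ring
import Summits.CriticalPhenomena.PercolationContinuityZ3.Theorems.PercNearOneGluingNoHeavyLowerTailKnQuestion8CoefficientwiseFibrePA
import HarnessLib

/-!
# Monotone product covers give twisted positive association — prim-lf-2 gen 61

Support file (`--supports stmt-CriticalPhenomena-4575`, closed), prover `prim-lf-2` (gen 61).  No definitions, no named facts, no sorries; standard axioms.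
Memo `prim-lf-2/CW-FIBRE-gen61.md` §0(vi) and §6 (the MONOTONE PRODUCT COVER form of the M-fibre conjecture); companion `…CoefficientwiseFibrePA.lean`
(`flipBlock_tsum_nonneg`, `twoSidedAvoidance_tsum_nonneg_of_fibrePA`).

If a finset `F` of colourings (red sets) is the image of a finite distributive lattice `α` (e.g. a product of chains) under a map `π : α → Finset ι` with all point
preimages of the same size, such that the red cluster `K ∘ π` is monotone and the blue cluster `(K (E ∖ ·)) ∘ π` is antitone, then the uniform measure on `F` is positively
associated for the twisted preorder — exactly the hypothesis `hPA` of `flipBlock_tsum_nonneg`.  Proof: Fortuin–Kasteleyn–Ginibre on `α` with the constant weight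
(Mathlib's `fkg`), pushed forward along `π`.
* `Coefficientwise.twistedPA_of_productCover` — the positive-association inequality `(Σ_F Φ)(Σ_F Ψ) ≤ |F| Σ_F ΦΨ` for twisted-monotone `Φ, Ψ`.
* `Coefficientwise.flipBlock_tsum_nonneg_of_productCover` — with flip-invariance of `F`: `0 ≤ Σ_{s∈F} T(K s, K(E∖s))`.
EVIDENCE for the cover form of the M-fibre conjecture (prim-lf-2 gen 61, prodall.c/prodsearch.c): every fibre of every connected graph on 4 vertices (m ≤ 6) and on 5
vertices (m ≤ 5) is such an image — 1 395 of 1 407 fibres bijectively (a product of chains), the remaining 12 (triangle + two pendant edges, |F| = 14) 2-to-1 from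
`[7]×[2]×[2]`.  [cite: KozmaNitzan2024, Questions 8–9 (§5.5 p. 36) (context: the Question-8 pocket covariance programme)]
-/

namespace Summit.CriticalPhenomena.PercolationContinuityZ3.Theorems

open Finset

namespace Coefficientwise

variable {ι V : Type*}

open Classical in
/-- **Twisted positive association from a monotone product cover.**  Let `α` be a finite distributive lattice, `π : α → Finset ι` with image inside `F` and all
preimages `{a | π a = s}` (`s ∈ F`) of the same positive size `d`, such that `a ≤ b → K (π a) ⊆ K (π b)` and `a ≤ b → K (E ∖ π b) ⊆ K (E ∖ π a)`.  Then for all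
`Φ Ψ : Finset ι → ℝ` monotone for the twisted preorder on `F`, `(Σ_F Φ)(Σ_F Ψ) ≤ |F| · Σ_F Φ Ψ`. [folklore] -/
theorem twistedPA_of_productCover {α : Type*} [DistribLattice α] [Fintype α] [DecidableEq ι]
    (E : Finset ι) (K : Finset ι → Set V) (F : Finset (Finset ι)) (π : α → Finset ι) (d : ℕ) (hd : 0 < d)
    (hπF : ∀ a, π a ∈ F) (hfib : ∀ s ∈ F, (univ.filter (fun a => π a = s)).card = d)
    (hmonoK : ∀ a b : α, a ≤ b → K (π a) ⊆ K (π b)) (hmonoB : ∀ a b : α, a ≤ b → K (E \ π b) ⊆ K (E \ π a))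
    (Φ Ψ : Finset ι → ℝ)
    (hΦ : ∀ s ∈ F, ∀ t ∈ F, K s ⊆ K t → K (E \ t) ⊆ K (E \ s) → Φ s ≤ Φ t)
    (hΨ : ∀ s ∈ F, ∀ t ∈ F, K s ⊆ K t → K (E \ t) ⊆ K (E \ s) → Ψ s ≤ Ψ t) :
    (∑ s ∈ F, Φ s) * (∑ s ∈ F, Ψ s) ≤ (F.card : ℝ) * ∑ s ∈ F, Φ s * Ψ s := by
  -- pull back to `α`, shift to make nonnegative, apply FKG with the constant weight
  by_cases hF : F = ∅
  · subst hF; simp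
  obtain ⟨s₀, hs₀⟩ := Finset.nonempty_iff_ne_empty.mpr hF
  -- lower bounds for the shift
  set cΦ : ℝ := F.inf' ⟨s₀, hs₀⟩ Φ with hcΦ
  set cΨ : ℝ := F.inf' ⟨s₀, hs₀⟩ Ψ with hcΨ
  set f : α → ℝ := fun a => Φ (π a) - cΦ with hf
  set g : α → ℝ := fun a => Ψ (π a) - cΨ with hg
  have hf0 : 0 ≤ f := fun a => by
    simp only [hf, Pi.zero_apply, sub_nonneg]; exact Finset.inf'_le _ (hπF a)
  have hg0 : 0 ≤ g := fun a => by
    simp only [hg, Pi.zero_apply, sub_nonneg]; exact Finset.inf'_le _ (hπF a)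
  have hfm : Monotone f := fun a b hab => by
    simp only [hf]; linarith [hΦ (π a) (hπF a) (π b) (hπF b) (hmonoK a b hab) (hmonoB a b hab)]
  have hgm : Monotone g := fun a b hab => by
    simp only [hg]; linarith [hΨ (π a) (hπF a) (π b) (hπF b) (hmonoK a b hab) (hmonoB a b hab)]
  have key := fkg (μ := fun _ : α => (1 : ℝ)) (f := f) (g := g) (fun _ => zero_le_one) hf0 hg0 hfm hgm
    (fun a b => by simp)
  simp only [one_mul, Finset.sum_const, Finset.card_univ, nsmul_eq_mul, mul_one] at key
  -- push forward: Σ_a h(π a) = d · Σ_{s∈F} h s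
  have push : ∀ h : Finset ι → ℝ, ∑ a : α, h (π a) = (d : ℝ) * ∑ s ∈ F, h s := by
    intro h
    rw [← Finset.sum_fiberwise_of_maps_to (s := (univ : Finset α)) (t := F) (g := π) (fun a _ => hπF a)]
    rw [Finset.mul_sum]
    refine Finset.sum_congr rfl fun s hs => ?_
    have : ∀ a ∈ univ.filter (fun a => π a = s), h (π a) = h s := fun a ha => by
      rw [(Finset.mem_filter.mp ha).2]
    rw [Finset.sum_congr rfl this, Finset.sum_const, hfib s hs, nsmul_eq_mul]
  have cardα : (Fintype.card α : ℝ) = (d : ℝ) * F.card := by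
    have := push (fun _ => (1 : ℝ))
    simp only [Finset.sum_const, Finset.card_univ, nsmul_eq_mul, mul_one] at this
    exact this
  -- rewrite `key` in terms of sums over `F`
  have e1 : ∑ a : α, f a = (d : ℝ) * ∑ s ∈ F, (Φ s - cΦ) := by simp only [hf]; exact push (fun s => Φ s - cΦ)
  have e2 : ∑ a : α, g a = (d : ℝ) * ∑ s ∈ F, (Ψ s - cΨ) := by simp only [hg]; exact push (fun s => Ψ s - cΨ)
  have e3 : ∑ a : α, f a * g a = (d : ℝ) * ∑ s ∈ F, (Φ s - cΦ) * (Ψ s - cΨ) := by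
    simp only [hf, hg]; exact push (fun s => (Φ s - cΦ) * (Ψ s - cΨ))
  rw [e1, e2, e3, cardα] at key
  -- `key : (d Σ(Φ-c))(d Σ(Ψ-c)) ≤ d |F| · d Σ (Φ-c)(Ψ-c)`; divide by d² and expand the shifts
  have hd' : (0 : ℝ) < d := by exact_mod_cast hd
  have key' : (∑ s ∈ F, (Φ s - cΦ)) * (∑ s ∈ F, (Ψ s - cΨ)) ≤ (F.card : ℝ) * ∑ s ∈ F, (Φ s - cΦ) * (Ψ s - cΨ) := by
    have h2 : (0 : ℝ) < (d : ℝ) * d := mul_pos hd' hd'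
    nlinarith [key, h2]
  have hN : (F.card : ℝ) = ∑ s ∈ F, (1 : ℝ) := by simp
  have ex1 : ∑ s ∈ F, (Φ s - cΦ) = ∑ s ∈ F, Φ s - F.card * cΦ := by
    rw [Finset.sum_sub_distrib, Finset.sum_const, nsmul_eq_mul]
  have ex2 : ∑ s ∈ F, (Ψ s - cΨ) = ∑ s ∈ F, Ψ s - F.card * cΨ := by
    rw [Finset.sum_sub_distrib, Finset.sum_const, nsmul_eq_mul]
  have ex3 : ∑ s ∈ F, (Φ s - cΦ) * (Ψ s - cΨ) =
      ∑ s ∈ F, Φ s * Ψ s - cΨ * ∑ s ∈ F, Φ s - cΦ * ∑ s ∈ F, Ψ s + F.card * (cΦ * cΨ) := by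
    have : ∀ s ∈ F, (Φ s - cΦ) * (Ψ s - cΨ) = Φ s * Ψ s - cΨ * Φ s - cΦ * Ψ s + cΦ * cΨ := fun s _ => by ring
    rw [Finset.sum_congr rfl this, Finset.sum_add_distrib, Finset.sum_sub_distrib, Finset.sum_sub_distrib, Finset.mul_sum, Finset.mul_sum,
      Finset.sum_const, nsmul_eq_mul]
  rw [ex1, ex2, ex3] at key'
  nlinarith [key']

open Classical in
/-- **T-sum on a flip-invariant block with a monotone product cover.**  Under the hypotheses of `twistedPA_of_productCover` and flip-invariance of `F`
(`s ∈ F → E ∖ s ∈ F`, `s ∈ F → s ⊆ E`): `0 ≤ Σ_{s∈F} (f(K s) − f(K(E∖s)))(g(K s) − g(K(E∖s)))` for monotone `f, g`. [folklore] -/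
theorem flipBlock_tsum_nonneg_of_productCover {α : Type*} [DistribLattice α] [Fintype α] [DecidableEq ι]
    (E : Finset ι) (K : Finset ι → Set V) (F : Finset (Finset ι)) (π : α → Finset ι) (d : ℕ) (hd : 0 < d)
    (hπF : ∀ a, π a ∈ F) (hfib : ∀ s ∈ F, (univ.filter (fun a => π a = s)).card = d)
    (hmonoK : ∀ a b : α, a ≤ b → K (π a) ⊆ K (π b)) (hmonoB : ∀ a b : α, a ≤ b → K (E \ π b) ⊆ K (E \ π a))
    (hFE : ∀ s ∈ F, s ⊆ E) (hflip : ∀ s ∈ F, E \ s ∈ F)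
    (f g : Set V → ℝ) (hf : Monotone f) (hg : Monotone g) :
    0 ≤ ∑ s ∈ F, (f (K s) - f (K (E \ s))) * (g (K s) - g (K (E \ s))) :=
  flipBlock_tsum_nonneg E K F f g hf hg hFE hflip
    (fun Φ Ψ hΦ hΨ => twistedPA_of_productCover E K F π d hd hπF hfib hmonoK hmonoB Φ Ψ hΦ hΨ)

end Coefficientwise

end Summit.CriticalPhenomena.PercolationContinuityZ3.Theorems
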